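import Literature.Computability.Complexity.Williams2014WitnessCheck
import Literature.Computability.Complexity.Williams2014AccWitnesses
import HarnessLib

/-!
# Williams' Theorem 3.2 split at Lemma 3.1: the generator `A` and the verifier `B` as named facts

Fourth layer under `williams_acc` / third under the named fact `Williams2014_thm_3_2`
(`Williams2014Transfer.lean`; R. Williams, *Nonuniform ACC circuit lower bounds*, J. ACM 61
(2014)). The printed proof of Theorem 3.2 (pp. 12–13; rerun at polynomial size in the proof of
Thm. 1.1, p. 18) has two halves:

* **Lemma 3.1** (pp. 10–12), the new ingredient: "There is a fixed `d > 0` with the following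
  property. Assume `P` has `ACC` circuits of depth `d'` and size at most `S(n)`. Further assume
  `ACC` CIRCUIT SAT on circuits with `n + c log n` inputs, depth `2d' + O(1)`, and at most
  `O(S(3n) + S(2n) n)` size can be solved in `O(2ⁿ/nᶜ)` time, for sufficiently large `c > 2d`.
  Then for every `L ∈ NTIME[2ⁿ]`, there is a nondeterministic algorithm `A` such that: `A` runs
  in `O(2ⁿ/nᶜ + S(3n) · poly(n))` time; for every `x` of length `n`, `A(x)` either prints
  *reject* or it prints an `ACC` circuit `C'ₓ` with `n + d log n` inputs, depth `d'`, and
  `S(n + d log n)` size, such that `x ∈ L` if and only if `C'ₓ` is the compression of a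
  satisfiable `3`-CNF formula of `2ⁿ · poly(n)` size; and there is always at least one
  computation path of `A(x)` that prints the circuit `C'ₓ`";
* **the machine `B`** (pp. 12–13): "`B` first runs the nondeterministic algorithm `A` of
  Lemma 3.1 … Then `B` nondeterministically guesses a `S(3n)`-size circuit `W` … constructs an
  `ACC` CIRCUIT SAT instance `D` to verify that `W` is correct … By assumption, the
  satisfiability of `D` can be determined in `O(2ⁿ/nᶜ)` time, hence `B` decides if `x ∈ L` in
  `O(2ⁿ/nᶜ)` time."

This file VENDORS the two halves as named facts over the tree's model and PROVES that together
they give `Williams2014_thm_3_2`: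

* `NGenerates t P` — *nondeterministic generation in time `O(t)`*, the verifier form of "a
  nondeterministic algorithm that prints reject or prints a `z` with `P x z`, some path
  printing": a relation `ok`, an output `out` and one `TM2` machine producing
  `ok x y :: out x y` on `⟨x, y⟩`, sound (`ok x y → P x (out x y)`) and complete (some short
  `y` has `ok x y`);
* `clauseCoordList`, `encodeAccCircuitList` — the print format of a family of circuits, one per
  clause coordinate (`ClauseCoord`, `Williams2014WitnessCheck.lean`), and
  `GoodClauseCircuits c cl m dG eG x z` — "`z` prints `accBasis m`-circuits of depth `≤ dG`,
  `≤ nᵉ + e` gates and fan-in, computing the clause map of `cl x`" (the tree's `C'ₓ`: one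
  single-output circuit per output bit);
* `PHasAccCircuits m d` — "`P` has `ACC` circuits of depth `d`" with one modulus (from
  `P ⊆ ACC0` by `exists_P_subset_depthSizeClass_of_P_subset_ACC0`,
  `Williams2014AccWitnesses.lean`);
* `Williams2014_lemma_3_1` — **Lemma 3.1** for the tree's succinct reductions (named fact);
* `Williams2014_thm_3_2_machineB` — **the machine `B`**: generator + succinct `ACC` witnesses
  + `ACC`-SAT algorithm give `L ∈ NTIME(n + 2ⁿ/n)` (named fact);
* `Williams2014_thm_3_2_of_parts` — **proved**: the two facts imply `Williams2014_thm_3_2`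
  (Lemma 5.1 supplies the uniform `ACC` circuits for `P` and the `ACC` witnesses:
  `exists_accSimulation_of_P_subset_ACC0`, `HasSuccinctAssignments.acc`).

## Faithfulness notes

* Lemma 3.1 is printed for `L ∈ NTIME[2ⁿ]` through the circuit `Cₓ` of Fact 3.1; in the tree
  Fact 3.1 is the clause function `cl` of `IsSuccinctReduction c L cl` (`Williams2014Transfer.lean`)
  and `C'ₓ` is a family of single-output circuits, one per bit of the fixed-width clause
  presentation (`clauseMap`, `ClauseCoord`; the tree's circuits have one output). The printed
  `C'ₓ` is correct iff "`x ∈ L` iff `C'ₓ` is the compression of a satisfiable formula"; we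
  require the stronger and actually established property that `C'ₓ` computes the clause map of
  `cl x` (p. 12: "`A` prints its guessed circuit `C'ₓ` if … EQUIV is [un]satisfiable", i.e.
  `C'ₓ ≡ Cₓ`), from which the printed one follows by `IsSuccinctReduction.mem_iff`.
* Hypotheses of Lemma 3.1: "`P` has `ACC` circuits of depth `d'`" is `PHasAccCircuits m d`
  (single modulus `m ≥ 2`, polynomial size); the SAT hypothesis is `AccSatInTime` for all
  depths and polynomial sizes at modulus `m` with an exponent `k` depending only on `c`
  ("for sufficiently large `c > 2d`"; here the number of inputs of the instances VALUE/EQUIV is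
  `n + O(c log n)` and `k = O(c)` suffices, the `L`-dependent constants being absorbed by the
  `O`-constant of the generator).
* Running times: Lemma 3.1's `O(2ⁿ/nᶜ + S(3n) poly(n))` and `B`'s `O(2ⁿ/nᶜ)` are both
  rendered as `O(williamsBound n) = O(n + 2ⁿ/n)`, the bound of `Williams2014_thm_3_2`.
  `NGenerates` asks the machine to halt within `c (t |x| + |y|) + c` steps on EVERY guess `y`
  (not only on guesses inside the length bound, as `NTIME` does): a generator is run by `B` on a
  prefix of `B`'s own witness, whose length is controlled by `B`'s constant, not `A`'s; the
  extra `|y|` pays for reading an overlong guess before rejecting it.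
* What is NOT here: the machines themselves. Lemma 3.1 needs P-uniform circuits for the clause
  function (tableau circuits with a polynomial-time gate-description function), the circuits
  VALUE and EQUIV and three SAT calls; `B` needs a polynomial-time TM2 function assembling the
  code of the instance `D` (`Williams2014WitnessCheck.lean`, made explicit) from the printed
  codes, the fan-in normalisation (`AccFanIn.lean`) and per-input composition of machines
  (`TM2ComputableAux.comp_outputsWithin`). Both remain named facts.

## References

* R. Williams, *Nonuniform ACC circuit lower bounds*, J. ACM 61(1) (2014) 2:1–2:32, Lemma 3.1
  (pp. 10–12), proof of Thm. 3.2 (pp. 12–13), proof of Thm. 1.1 (p. 18) [Williams2014].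
* S. Arora, B. Barak, *Computational Complexity: A Modern Approach*, CUP 2009, Def. 2.1
  (verifier form of nondeterministic time) [AroraBarak2009].
-/

namespace Literature.Computability.Complexity

open _root_.Computability Turing Polynomial

/-! ### Nondeterministic generation in time `O(t)` -/

/-- **Nondeterministic generation** of strings with property `P x ·` in time `O(t)`, verifier
form (cf. `NTIME`, `Nondeterministic.lean`; Williams 2014, Lemma 3.1: "a nondeterministic
algorithm `A` such that … `A(x)` either prints reject or it prints [a `z` with `P x z`] … there
is always at least one computation path of `A(x)` that prints"): a constant `c`, an acceptance
relation `ok`, an output function `out` and a `TM2` machine `M` which on `⟨x, y⟩` (every guess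
`y`) halts within `c · (t |x| + |y|) + c` steps printing the flag `ok x y` followed by
`out x y`; accepted outputs are good (`ok x y → P x (out x y)`); and for every `x` some guess of
length `≤ c · t |x| + c` is accepted. [cite: Williams2014, Lemma 3.1] -/
def NGenerates (t : ℕ → ℕ) (P : List Bool → List Bool → Prop) : Prop :=
  ∃ (c : ℕ) (ok : List Bool → List Bool → Bool) (out : List Bool → List Bool → List Bool)
    (M : TM2ComputableAux Bool Bool),
    (∀ x y : List Bool,
      M.OutputsWithin (boolPair x y) (ok x y :: out x y) (c * (t x.length + y.length) + c)) ∧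
    (∀ x y : List Bool, ok x y = true → P x (out x y)) ∧
    (∀ x : List Bool, ∃ y : List Bool, y.length ≤ c * t x.length + c ∧ ok x y = true)

/-- Generation is monotone in the generated property. [folklore] -/
theorem NGenerates.mono {t : ℕ → ℕ} {P Q : List Bool → List Bool → Prop} (h : NGenerates t P)
    (hPQ : ∀ x z, P x z → Q x z) : NGenerates t Q := by
  obtain ⟨c, ok, out, M, hM, hP, hex⟩ := h
  exact ⟨c, ok, out, M, hM, fun x y hy => hPQ _ _ (hP x y hy), hex⟩

/-- Sanity: every generated property is inhabited at every input. [folklore] -/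
theorem NGenerates.exists {t : ℕ → ℕ} {P : List Bool → List Bool → Prop} (h : NGenerates t P)
    (x : List Bool) : ∃ z, P x z := by
  obtain ⟨c, ok, out, M, -, hP, hex⟩ := h
  obtain ⟨y, -, hy⟩ := hex x
  exact ⟨out x y, hP x y hy⟩

/-! ### The print format of the clause circuits `C'ₓ` -/

/-- The clause coordinates in print order: slot by slot, occupancy bit, polarity bit, then the
index bits `0, …, w - 1` (a design choice of this file). [folklore] -/
def clauseCoordList (w : ℕ) : List (ClauseCoord w) :=
  (List.finRange 3).flatMap fun ℓ =>
    (ℓ, Sum.inl false) :: (ℓ, Sum.inl true) :: (List.finRange w).map fun j => (ℓ, Sum.inr j)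

/-- Every clause coordinate is printed. [folklore] -/
theorem mem_clauseCoordList {w : ℕ} (κ : ClauseCoord w) : κ ∈ clauseCoordList w := by
  obtain ⟨ℓ, f⟩ := κ
  simp only [clauseCoordList, List.mem_flatMap, List.mem_finRange, true_and, List.mem_cons,
    List.mem_map]
  refine ⟨ℓ, ?_⟩
  rcases f with (_ | _) | j
  · exact Or.inl rfl
  · exact Or.inr (Or.inl rfl)
  · exact Or.inr (Or.inr ⟨j, rfl⟩)

/-- The number of printed coordinates is `3 (w + 2)`. [folklore] -/
theorem length_clauseCoordList (w : ℕ) : (clauseCoordList w).length = 3 * (w + 2) := by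
  simp [clauseCoordList, List.length_flatMap]
  ring

/-- **The print format of a list of circuits over `accBasis m`**: the list of their codes
`circuitCodeList m` (`Williams2014.lean`) in the tree's list-of-lists-of-naturals encoding
(`encodingListNatBool.listBool`; injective on circuits over `accBasis m` by
`circuitCodeList_injOn`). [folklore] -/
def encodeAccCircuitList (m : ℕ) {n : ℕ} (Cs : List (Circuit (Fin n))) : List Bool :=
  encodingListNatBool.listBool.encode (Cs.map (circuitCodeList m))

/-- **Good printouts of the generator of Lemma 3.1** for the succinct reduction `cl` (constant
`c`) at input `x`, modulus `m`, depth `dG`, exponent `eG`: `z` prints, along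
`clauseCoordList`, circuits `G κ` over `accBasis m` on `w = succinctWidth c |x|` inputs with
`acDepth ≤ dG`, at most `|x| ^ eG + eG` gates and fan-in at most `|x| ^ eG + eG`, the circuit
`G κ` computing coordinate `κ` of the clause map of `cl x` (Williams 2014, Lemma 3.1: "prints
an `ACC` circuit `C'ₓ` with `n + d log n` inputs, depth `d'`, and `S(n + d log n)` size" that
is equivalent to `Cₓ`). [cite: Williams2014, Lemma 3.1] -/
def GoodClauseCircuits (c : ℕ) (cl : List Bool → ℕ → Clause ℕ) (m dG eG : ℕ) (x z : List Bool) :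
    Prop :=
  ∃ G : ClauseCoord (succinctWidth c x.length) → Circuit (Fin (succinctWidth c x.length)),
    (∀ κ, (G κ).IsOver (accBasis m) ∧ (G κ).acDepth ≤ dG ∧ (G κ).size ≤ x.length ^ eG + eG ∧
      (G κ).maxFanIn ≤ x.length ^ eG + eG ∧
        ∀ i, (G κ).eval i = clauseMap (succinctWidth c x.length) (cl x) i κ) ∧
    z = encodeAccCircuitList m ((clauseCoordList (succinctWidth c x.length)).map G)

/-- A good printout determines circuits realizing the whole clause map as one layer over
`accBasis m` of depth `dG` with `3 (w + 2) (|x| ^ eG + eG)` gates (juxtaposition,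
`acVecOver_ofBlocks_fintype_const`) — the input `hG` of `exists_satInstance`
(`Williams2014WitnessCheck.lean`). [folklore] -/
theorem GoodClauseCircuits.acVecOver {c m dG eG : ℕ} {cl : List Bool → ℕ → Clause ℕ}
    {x z : List Bool} (h : GoodClauseCircuits c cl m dG eG x z) :
    ACVecOver (accBasis m) (clauseMap (succinctWidth c x.length) (cl x)) dG
      (Fintype.card (ClauseCoord (succinctWidth c x.length)) * (x.length ^ eG + eG)) := by
  obtain ⟨G, hG, -⟩ := h
  have hblocks : ∀ κ, ACRealOver (accBasis m)
      (fun i => clauseMap (succinctWidth c x.length) (cl x) i κ) dG (x.length ^ eG + eG) :=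
    fun κ => (ACRealOver.of_circuit (G κ) (hG κ).1 (hG κ).2.1 (hG κ).2.2.1).congr (hG κ).2.2.2.2
  exact acVecOver_ofBlocks_fintype_const hblocks

/-! ### "`P` has `ACC` circuits of depth `d`" -/

/-- **"`P` has `ACC` circuits of depth `d'` and size at most `S(n)`"** (the hypothesis of
Williams 2014, Lemma 3.1, polynomial `S`) with one modulus `m`: every language of `P` is
decided by a family of circuits over `accBasis m` of `acDepth ≤ d` and polynomial size.
Supplied from `P ⊆ ACC0` by Lemma 5.1 (`exists_pHasAccCircuits_of_P_subset_ACC0`).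
[cite: Williams2014, Lemma 3.1 (hypothesis)] -/
def PHasAccCircuits (m d : ℕ) : Prop :=
  Classes.P ⊆ ⋃ p : Polynomial ℕ, DepthSizeClass (accBasis m) (fun _ => d) (fun n => p.eval n)

/-- `P ⊆ ACC0` gives `PHasAccCircuits m d` for some `m ≥ 2` and `d` (Lemma 5.1, circuit level;
`Williams2014AccWitnesses.lean`). [cite: Williams2014, Lemma 5.1] -/
theorem exists_pHasAccCircuits_of_P_subset_ACC0 (hP : Classes.P ⊆ ACC0) :
    ∃ m : ℕ, 2 ≤ m ∧ ∃ d : ℕ, PHasAccCircuits m d :=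
  exists_P_subset_depthSizeClass_of_P_subset_ACC0 hP

/-- Under `AccSimulation m d q`, `PHasAccCircuits m d`. [cite: Williams2014, Lemma 5.1] -/
theorem AccSimulation.pHasAccCircuits {m d : ℕ} {q : Polynomial ℕ} (h : AccSimulation m d q) :
    PHasAccCircuits m d :=
  fun _ hL => h.PPoly_subset (P_subset_PPoly_holds hL)

/-! ### Monotonicity of the SAT hypothesis in the exponent -/

/-- An `O(2ⁿ/n^{k'})` satisfiability algorithm is an `O(2ⁿ/nᵏ)` algorithm for `k ≤ k'`.
[folklore] -/
theorem AccSatInTime.of_pow_le {d m k k' : ℕ} {s : ℕ → ℕ}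
    (h : AccSatInTime d m s (fun n => 2 ^ n / n ^ k')) (hk : k ≤ k') :
    AccSatInTime d m s (fun n => 2 ^ n / n ^ k) := by
  refine h.of_le_of_bdd 1 1 (fun n hn => ?_) (fun n hn => ?_)
  · exact Nat.div_le_div_left (Nat.pow_le_pow_right hn hk) (Nat.pow_pos hn)
  · have : n = 0 := by omega
    subst this
    exact (Nat.div_le_self _ _).trans (by simp)

/-! ### The two halves of the proof of Theorem 3.2 as named facts -/

/-- **Williams 2014, Lemma 3.1** (guess-and-verify an equivalent `ACC` circuit), for the
tree's succinct reductions. For every constant `c` there is an exponent `k` such that for every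
language `L` with a succinct reduction `cl` of constant `c` (Fact 3.1), every modulus `m ≥ 2`
and depth `d`: if `P` has `accBasis m`-circuits of depth `d` and polynomial size
(`PHasAccCircuits m d`: "Assume `P` has `ACC` circuits of depth `d'` and size at most `S(n)`")
and satisfiability of `accBasis m`-circuits of any fixed depth and polynomial size (gates and
fan-in) on `n` inputs is decidable in deterministic time `O(2ⁿ/nᵏ)` (`AccSatInTime`: "assume
`ACC` CIRCUIT SAT on circuits with `n + c log n` inputs, depth `2d' + O(1)`, and at most
`O(S(3n) + S(2n) n)` size can be solved in `O(2ⁿ/nᶜ)` time, for sufficiently large `c > 2d`"),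
then for some depth `dG` and exponent `eG` the clause circuits `C'ₓ` — `accBasis m`-circuits
of depth `≤ dG`, `≤ nᵉ + e` gates and fan-in, computing the clause map of `cl x`
(`GoodClauseCircuits`) — are nondeterministically generated in time `O(n + 2ⁿ/n)`
(`NGenerates williamsBound`: "`A` runs in `O(2ⁿ/nᶜ + S(3n) · poly(n))` time … either prints
reject or it prints an `ACC` circuit `C'ₓ` … there is always at least one computation path of
`A(x)` that prints the circuit `C'ₓ`"). Printed proof: guess `ACC` circuits `D` (gate
information of `Cₓ`), `E` (gate values of `Cₓ`) and `C'ₓ`; check `D` against the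
polynomial-time description of `Cₓ`, `E` by a SAT call on VALUE, `C'ₓ` by SAT calls on EQUIV.
[cite: Williams2014, Lemma 3.1] -/
def Williams2014_lemma_3_1 : Prop :=
  ∀ c : ℕ, ∃ k : ℕ, ∀ (L : Language Bool) (cl : List Bool → ℕ → Clause ℕ) (m d : ℕ),
    IsSuccinctReduction c L cl → 2 ≤ m → PHasAccCircuits m d →
      (∀ d' e : ℕ, AccSatInTime d' m (fun n => n ^ e + e) (fun n => 2 ^ n / n ^ k)) →
        ∃ dG eG : ℕ, NGenerates williamsBound (GoodClauseCircuits c cl m dG eG)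

/-- **Williams 2014, proof of Thm. 3.2: the machine `B`** (pp. 12–13, with the polynomial-size
witnesses of the proof of Thm. 1.1, p. 18). For every constant `c` there is an exponent `k` such
that for every language `L` with a succinct reduction `cl` of constant `c`, modulus `m ≥ 2`,
depths `dG, dW` and exponent `eG`: if the clause circuits are nondeterministically generated in
time `O(n + 2ⁿ/n)` ("`B` first runs the nondeterministic algorithm `A` of Lemma 3.1 … for some
computation path, `A` produces an `ACC` circuit `C'ₓ`"), `L` has succinct satisfying
assignments encoded by `accBasis m`-circuits of depth `≤ dW` (`HasSuccinctAccAssignments`: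
"`B` nondeterministically guesses a `S(3n)`-size circuit `W`. By Fact 3.2, there exists such a
`W`"), and `accBasis m`-SAT of any fixed depth and polynomial size is in time `O(2ⁿ/nᵏ)`
(`AccSatInTime`), then `L ∈ NTIME(n + 2ⁿ/n)` (`williamsBound`; "`B` constructs an `ACC`
CIRCUIT SAT instance `D` to verify that `W` is correct … `D` has `O(n S(2n) + S(3n))` size,
depth `2d + O(1)`, and `n + c log n` inputs. By assumption, the satisfiability of `D` can be
determined in `O(2ⁿ/nᶜ)` time, hence `B` decides if `x ∈ L` in `O(2ⁿ/nᶜ)` time"; the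
instance `D` and its correctness are `exists_satInstance`, `Williams2014WitnessCheck.lean`).
[cite: Williams2014, proof of Thm. 3.2 (pp. 12–13)] -/
def Williams2014_thm_3_2_machineB : Prop :=
  ∀ c : ℕ, ∃ k : ℕ, ∀ (L : Language Bool) (cl : List Bool → ℕ → Clause ℕ) (m dG eG dW : ℕ),
    IsSuccinctReduction c L cl → 2 ≤ m →
      NGenerates williamsBound (GoodClauseCircuits c cl m dG eG) →
        HasSuccinctAccAssignments c L cl m dW →
          (∀ d e : ℕ, AccSatInTime d m (fun n => n ^ e + e) (fun n => 2 ^ n / n ^ k)) →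
            L ∈ NTIME williamsBound

/-! ### Proved: Theorem 3.2 from its two halves -/

/-- **Williams 2014, Thm. 3.2 (polynomial rerun) from Lemma 3.1 and the machine `B`**: given a
succinct reduction of `L`, succinct satisfying assignments, `P ⊆ ACC0` and the `ACC`-SAT
algorithms, Lemma 5.1 (`exists_accSimulation_of_P_subset_ACC0`) provides one modulus `m ≥ 2`
and depth `d` with `ACC` circuits for all of `P` (`AccSimulation.pHasAccCircuits`) and turns
the witnesses into `ACC` witnesses (`HasSuccinctAssignments.acc`); Lemma 3.1 generates the
clause circuits; `B` concludes. The exponent is the larger of the two exponents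
(`AccSatInTime.of_pow_le`). [cite: Williams2014, proof of Thm. 3.2 and of Thm. 1.1 (p. 18)] -/
theorem Williams2014_thm_3_2_of_parts (hA : Williams2014_lemma_3_1)
    (hB : Williams2014_thm_3_2_machineB) : Williams2014_thm_3_2 := by
  intro c
  obtain ⟨k₁, hk₁⟩ := hA c
  obtain ⟨k₂, hk₂⟩ := hB c
  refine ⟨max k₁ k₂, fun L cl hred hW hP hsat => ?_⟩
  obtain ⟨m, hm, d, q, hS⟩ := exists_accSimulation_of_P_subset_ACC0 hP
  obtain ⟨dG, eG, hgen⟩ := hk₁ L cl m d hred hm hS.pHasAccCircuits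
    fun d' e => (hsat d' m e hm).of_pow_le (le_max_left _ _)
  exact hk₂ L cl m dG eG d hred hm hgen (hW.acc hS)
    fun d' e => (hsat d' m e hm).of_pow_le (le_max_right _ _)

/-- The resulting component list of `williams_acc` (Williams 2014, Thm. 1.1): Fact 3.1, IKW's
Thm. 5.2, Lemma 3.1, the machine `B`, the nondeterministic time hierarchy theorem and the
`ACC`-SAT algorithm of Thm. 4.1. [cite: Williams2014, Thm. 1.1 and its proof] -/
theorem williams_acc_of_lemma_3_1_components (h31 : Williams2014_fact_3_1)
    (h52 : Williams2014_thm_5_2) (hA : Williams2014_lemma_3_1)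
    (hB : Williams2014_thm_3_2_machineB) (hH : ntime_hierarchy)
    (h41 : Williams2014_accSat_polysize) : williams_acc :=
  williams_acc_of_ikw_components h31 h52 (Williams2014_thm_3_2_of_parts hA hB) hH h41

/-- The same for the transfer theorem alone (Williams 2014, Thm. 1.3 for `ACC`,
`Williams2014_lowerBound_of_accSat`). [cite: Williams2014, Thm. 1.3] -/
theorem Williams2014_lowerBound_of_accSat_of_lemma_3_1 (h31 : Williams2014_fact_3_1)
    (h52 : Williams2014_thm_5_2) (hA : Williams2014_lemma_3_1)
    (hB : Williams2014_thm_3_2_machineB) (hH : ntime_hierarchy) :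
    Williams2014_lowerBound_of_accSat :=
  Williams2014_lowerBound_of_accSat_of_deep h31 (Williams2014_thm_5_1_of_thm_5_2 h52)
    (Williams2014_thm_3_2_of_parts hA hB) hH

end Literature.Computability.Complexity
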